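import Summits.QuantumFields.BalabanUV.T4Continuum.Support.CovariantMeanPropagation
import Summits.QuantumFields.BalabanUV.T4Continuum.Support.CovariantMeanLatticeDepth

/-!
# `T4Continuum.CovariantMeanLatticeLaws` (cell-tree module `Summits/QuantumFields/BalabanUV/T4Continuum/Support/CovariantMeanLatticeLaws.lean`)
# — road P4 of the spine estimate NE1′, tangent-map formulation (v2): THE DEPTH LAW OF `StepLaws` IS INHABITED BY THE LATTICE
# DEPTH LEMMA — in the lattice model of `CovariantMeanLatticeDisc` (configurations `𝔅 → 𝔸`, class = «differentiable on the
# level's analyticity domain and vanishing at the trivial configuration», regular configurations = pure-potential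
# configurations `exp B` with listed plaquettes within `δ j` and potentials within `β j`), the field `dl` of
# `CovariantMeanPropagation.StepLaws` is PROVED from `depth_gain_lattice` under the road's numeric side conditions, while the
# two halves of the insertion lemma (`il_loc`, `il_an`) and the additivity of the correction stay INPUTS (`LatticeStepData`);
# the wiring theorem of `CovariantMeanPropagation` then applies verbatim (`norm_propagate_le_geometric_lattice`)
# (cell `pub-balaban`, sub-cell `t4`, ROUND-2 prover seat #4 of BINDER-OWNERS row NE1′, unit `b2b-balaban-t4-ne1p-p4`,
# generation 3; companion of the skeleton `t4/skeletons/NE1p-t4-ne1p-p4.md` v2.5 node P; ADDITIVE — imports its siblings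
# `Support.CovariantMeanPropagation` and `Support.CovariantMeanLatticeDepth` only; nothing modified)

HONEST FRAMING.  Finite four-torus, rung (B)+1 only.  NOT infinite volume, NOT a mass gap, NOT the Clay problem, NOT summit
progress.  HONEST DEPENDENCY: continuum YM on T⁴ ⇐ BetaPertH ∧ nine spine estimates (0/9 proved); BetaPertH ⇐ (D1) ∧ (D4) ∧
CAP+tail; G-an2-4 gates asym, D1 and NE2/3/4.  Elementary; every declaration [folklore] and sorry-free; the residues (r1)–(r4)
of `CovariantMeanLatticeDisc` apply (containment SHAPE `ContainsSmall`, axial gauge as the letters `β j`, flatness-zero as the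
class condition `Φ 1 = 0`, linear ambient space); `il_loc` / `il_an` are asserted of nothing.

CITATION HEADER (lean-in-tree rule).  No page of the series (CMP 1983–89) or of any other source is quoted or attributed here.
Objects re-used BY NAME: `CovariantMeanLatticeDisc.depth_gain_lattice` / `ContainsSmall` / `discHol` (p211462),
`CovariantMeanPropagation.StepLaws` and its wiring theorems (this seat).
-/

noncomputable section

open NormedSpace Set Metric Finset

namespace Summit.QuantumFields.BalabanUV.T4Continuum.CovariantMeanLatticeLaws

open CovariantMeanLatticeDisc (discHol ContainsSmall depth_gain_lattice)
open CovariantMeanPropagation (StepLaws ySeq)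

variable {𝔅 : Type*} [Fintype 𝔅] {𝔸 : Type*} [NormedRing 𝔸] [NormedAlgebra ℂ 𝔸] [CompleteSpace 𝔸]
  {F : Type*} [NormedAddCommGroup F] [NormedSpace ℂ F]

/-- THE LATTICE STEP DATA.  Per level `j`: an open analyticity domain `S j` containing the small pure-potential configurations of
radii `(a j, ρ j)` (the containment shape), the regularity letters `δ j` (listed plaquette deviations) and `β j ≥ 0` (potentials)
of the level-`j` regular configurations, a plaquette list; constants `C ≥ 1`, `r > 0`; the NUMERIC SIDE CONDITIONS of the
depth lemma for every pair of levels `i < j` with `Λ = (C·r^{j−i})⁻¹` (`hΛ`, `h4`, `ha`, `hρ`) and for `i = j` the plain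
containment (`hδa`, `hβρ`); and the one-step correction `corr` with its additivity and the two halves of the insertion lemma
as INPUTS (`il_loc`, `il_an`) for the class «differentiable on `S i`, zero at `1`». [folklore] -/
structure LatticeStepData (𝔅 𝔸 F : Type*) [Fintype 𝔅] [NormedRing 𝔸] [NormedAlgebra ℂ 𝔸] [CompleteSpace 𝔸]
    [NormedAddCommGroup F] [NormedSpace ℂ F] where
  /-- analyticity domains -/
  S : ℕ → Set (𝔅 → 𝔸)
  /-- plaquette list -/
  plaqs : Set (𝔅 × 𝔅 × 𝔅 × 𝔅)
  /-- birth (plaquette) radii -/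
  a : ℕ → ℝ
  /-- potential radii -/
  ρ : ℕ → ℝ
  /-- plaquette deviation of level-`j` regular configurations -/
  δ : ℕ → ℝ
  /-- potential size of level-`j` regular configurations -/
  β : ℕ → ℝ
  /-- depth constant -/
  C : ℝ
  /-- depth rate -/
  r : ℝ
  /-- relative size of a correction -/
  ε : ℝ
  /-- the one-step correction -/
  corr : ℕ → ((𝔅 → 𝔸) → F) → ((𝔅 → 𝔸) → F)
  isOpen : ∀ j, IsOpen (S j)
  contains : ∀ j, ContainsSmall (S j) plaqs (a j) (ρ j)
  hβ : ∀ j, 0 ≤ β j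
  hC : 1 ≤ C
  hr : 0 < r
  hδa : ∀ j, δ j < a j
  hβρ : ∀ j, β j < ρ j
  hΛ : ∀ i j, i < j → 1 < (C * r ^ (j - i))⁻¹
  h4 : ∀ i j, i < j → 4 * (C * r ^ (j - i))⁻¹ * β j ≤ 1
  ha : ∀ i j, i < j → (C * r ^ (j - i))⁻¹ * δ j + 32 * ((C * r ^ (j - i))⁻¹) ^ 2 * β j ^ 2 < a i
  hρ : ∀ i j, i < j → (C * r ^ (j - i))⁻¹ * β j < ρ i
  corr_add : ∀ j Φ Ψ, corr j (Φ + Ψ) = corr j Φ + corr j Ψ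
  il_loc : ∀ i j (Φ : (𝔅 → 𝔸) → F), i ≤ j → (DifferentiableOn ℂ Φ (S i) ∧ Φ 1 = 0) →
    (DifferentiableOn ℂ (corr j Φ) (S (j + 1)) ∧ corr j Φ 1 = 0)
  il_an : ∀ i j (Φ : (𝔅 → 𝔸) → F) (M : ℝ), i ≤ j → (DifferentiableOn ℂ Φ (S i) ∧ Φ 1 = 0) →
    (∀ W, (∃ B : 𝔅 → 𝔸, W = (fun b => exp (B b)) ∧ (∀ b, ‖B b‖ ≤ β j) ∧ ∀ p ∈ plaqs, ‖discHol B p 1 - 1‖ ≤ δ j) →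
      ‖Φ W‖ ≤ M) → ∀ V ∈ S (j + 1), ‖corr j Φ V‖ ≤ ε * M

namespace LatticeStepData

variable (Λ : LatticeStepData 𝔅 𝔸 F)

/-- The level-`j` regular configurations of the lattice model: pure-potential configurations `exp B` with potentials `≤ β j`
and listed plaquette deviations `≤ δ j`. [folklore] -/
def Reg (j : ℕ) : Set (𝔅 → 𝔸) :=
  {W | ∃ B : 𝔅 → 𝔸, W = (fun b => exp (B b)) ∧ (∀ b, ‖B b‖ ≤ Λ.β j) ∧ ∀ p ∈ Λ.plaqs, ‖discHol B p 1 - 1‖ ≤ Λ.δ j}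

/-- The class of the lattice model at level `j`: differentiable on `S j` and vanishing at the trivial configuration.
[folklore] -/
def Good (j : ℕ) (Φ : (𝔅 → 𝔸) → F) : Prop := DifferentiableOn ℂ Φ (Λ.S j) ∧ Φ 1 = 0

/-- Regular configurations lie in their own level's domain (containment at `ζ = 1`). [folklore] -/
theorem reg_subset_S (j : ℕ) : Λ.Reg j ⊆ Λ.S j := by
  rintro W ⟨B, rfl, hB, hP⟩
  apply Λ.contains j B
  refine ⟨fun p hp => ?_, fun b => lt_of_le_of_lt (hB b) (Λ.hβρ j)⟩
  have h := hP p hp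
  have e : discHol B p 1 = exp (B p.1) * exp (B p.2.1) * exp (-(B p.2.2.1)) * exp (-(B p.2.2.2)) := by
    simp [discHol]
  rw [← e]; exact lt_of_le_of_lt h (Λ.hδa j)

/-- **THE DEPTH LAW HOLDS IN THE LATTICE MODEL**: a class member of level `i` bounded by `N` on `S i` is bounded by
`C·r^{j−i}·N` on the level-`j` regular configurations — for `i < j` by `depth_gain_lattice` with `Λ = (C·r^{j−i})⁻¹`, for
`i = j` by containment and `C ≥ 1`. [folklore] -/
theorem dl (i j : ℕ) (Φ : (𝔅 → 𝔸) → F) (N : ℝ) (hij : i ≤ j) (hΦ : Λ.Good i Φ) (hN : ∀ V ∈ Λ.S i, ‖Φ V‖ ≤ N) :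
    ∀ V ∈ Λ.Reg j, ‖Φ V‖ ≤ Λ.C * Λ.r ^ (j - i) * N := by
  rintro W ⟨B, rfl, hB, hP⟩
  rcases Nat.lt_or_ge i j with hlt | hge
  · -- genuine depth: Schwarz along the disc of radius `(C r^{j-i})⁻¹`
    have hgain := depth_gain_lattice (Λ.isOpen i) (Λ.contains i) hΦ.1 hN hΦ.2 (Λ.hβ j) hB hP (Λ.hΛ i j hlt)
      (Λ.h4 i j hlt) (Λ.ha i j hlt) (Λ.hρ i j hlt)
    have hpos : 0 < Λ.C * Λ.r ^ (j - i) := mul_pos (lt_of_lt_of_le zero_lt_one Λ.hC) (pow_pos Λ.hr _)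
    calc ‖Φ fun b => exp (B b)‖ ≤ N / (Λ.C * Λ.r ^ (j - i))⁻¹ := hgain
      _ = Λ.C * Λ.r ^ (j - i) * N := by rw [div_inv_eq_mul, mul_comm]
  · -- same level: containment and `C ≥ 1`
    have hij' : i = j := le_antisymm hij hge
    subst hij'
    have hmem : (fun b => exp (B b)) ∈ Λ.S i := Λ.reg_subset_S i ⟨B, rfl, hB, hP⟩
    have h1 := hN _ hmem
    have hN0 : 0 ≤ N := (norm_nonneg _).trans h1
    rw [Nat.sub_self, pow_zero, mul_one]
    nlinarith [Λ.hC]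

/-- **THE STEP LAWS OF THE LATTICE MODEL**: `dl` is the theorem above; the class is closed under `0` and `+`; `il_loc`,
`il_an` and additivity are the data's inputs. [folklore] -/
def stepLaws : StepLaws (𝔅 → 𝔸) F where
  D := Λ.S
  Reg := Λ.Reg
  Good := Λ.Good
  corr := Λ.corr
  C := Λ.C
  r := Λ.r
  ε := Λ.ε
  good_zero := fun j => ⟨differentiableOn_const 0, rfl⟩
  good_add := fun j Φ Ψ hΦ hΨ => ⟨hΦ.1.add hΨ.1, by simp [hΦ.2, hΨ.2]⟩
  corr_add := Λ.corr_add
  dl := fun i j Φ N hij hΦ hN => Λ.dl i j Φ N hij hΦ hN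
  il_loc := fun i j Φ hij hΦ => Λ.il_loc i j Φ hij hΦ
  il_an := fun i j Φ M hij hΦ hM => Λ.il_an i j Φ M hij hΦ (fun W hW => hM W hW)

/-- **THE WIRING THEOREM IN THE LATTICE MODEL.**  A functional differentiable on `S 0`, vanishing at `1`, bounded by `y₀ ≥ 0`
there, propagates under `X (j+1) = X j + corr j (X j)` to a functional bounded on the level-`j` regular configurations by
`2C·(r(1+η))^j·(C·y₀)`, whenever `0 ≤ ε ≤ rη/(2C)` — the depth law being DISCHARGED by the lattice depth lemma, the two halves
of the insertion lemma being the inputs. [folklore] -/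
theorem norm_propagate_le_geometric_lattice (X₀ : (𝔅 → 𝔸) → F) {y₀ η : ℝ} (hX : DifferentiableOn ℂ X₀ (Λ.S 0))
    (h1 : X₀ 1 = 0) (hX₀ : ∀ V ∈ Λ.S 0, ‖X₀ V‖ ≤ y₀) (hy₀ : 0 ≤ y₀) (hη : 0 < η) (hε0 : 0 ≤ Λ.ε)
    (hε : Λ.ε ≤ Λ.r * η / (2 * Λ.C)) (j : ℕ) :
    ∀ V ∈ Λ.Reg j, ‖Λ.stepLaws.propagate X₀ j V‖ ≤ 2 * Λ.C * (Λ.r * (1 + η)) ^ j * (Λ.C * y₀) :=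
  Λ.stepLaws.norm_propagate_le_geometric X₀ ⟨hX, h1⟩ hX₀ hy₀ Λ.hC Λ.hr hη hε0 hε j

end LatticeStepData

end Summit.QuantumFields.BalabanUV.T4Continuum.CovariantMeanLatticeLaws

end
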